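import Literature.NumberTheory.ComplexMultiplication.CMTypeRankCharactersFamilies
import Literature.AlgebraicGeometry.Pohlmann1968.CMTypeRankCharactersNumberField
import Literature.AlgebraicGeometry.Pohlmann1968.NondegenerateCMAlgebraTypes
import HarnessLib

/-!
# Kubota's character formula for families of CM types of CM fields inside one ABELIAN number field:
# `rank Hg(∏_i A_{Φ_i}) = #{χ ∈ Gal(L/ℚ)^ odd : some Φ_i has Σ_{g : ι∘g∘e_i ∈ Φ_i} χ(g) ≠ 0}`

Number-field dress of `CMTypeRankCharactersFamilies` (Kubota's Lemma 2 for FAMILIES, for a finite commutative group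
acting on itself slot by slot), in the style of `Pohlmann1968/CMTypeRankCharactersNumberField` (one type).  Setting:
CM fields `K_i` (`i ∈ I` finite) with ring embeddings `e_i : K_i → L` into ONE number field `L` which is an ABELIAN
extension of `ℚ` (Mathlib's `IsAbelianGalois`; e.g. a cyclotomic field containing all `K_i`), a complex embedding
`ι : L → ℂ`, the complex conjugation `ρ ∈ G = Gal(L/ℚ)` (`ι ∘ ρ = conj ∘ ι`).  Every complex embedding of `K_i` is
`ι ∘ g ∘ e_i`, and `Aut(ℂ)` acts on `⊔_i Hom(K_i, ℂ)` through `G` (`τ ∘ ι = ι ∘ r(τ)`), so: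

* `cmFamilyRank_eq_typeRank_gal`, `cmTypeRank_eq_typeRank_gal_member` — the DICTIONARY: Deligne's `cmFamilyRank Φ`
  (translates under `Aut(ℂ)`) is the rank of the family `Ψ_i = {g ∈ G | ι ∘ g ∘ e_i ∈ Φ_i}` of types of `G`;
* **`cmFamilyRank_eq_one_add_ncard_oddCharacters`** — **Kubota's Lemma 2 for families**:
  `cmFamilyRank Φ = 1 + #{χ : G → ℂˣ | χ(ρ) = −1 ∧ ∃ i, Σ_{g : ι∘g∘e_i ∈ Φ_i} χ(g) ≠ 0}`;
  **`cmTypeRank_eq_one_add_ncard_oddCharacters_member`** — one member: `cmTypeRank Φ_i = 1 + |S_i|`,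
  `S_i = {χ odd : Σ_{g : ι∘g∘e_i ∈ Φ_i} χ(g) ≠ 0}` (Gordon 9.4.1 read on `Gal(L/ℚ)` instead of `Gal(K_i/ℚ)`);
* **`cmFamilyRank_add_card_add_sum_eq`** — the MULTIPLICITY FORMULA: with `n_χ = #{i : χ ∈ S_i}`,
  `cmFamilyRank Φ + |I| + Σ_χ (n_χ − 1) = Σ_i cmTypeRank Φ_i + 1` — the additivity defect
  `Σ_i rank Hg(A_i) − rank Hg(∏_i A_i)` is the total excess multiplicity `Σ_χ (n_χ − 1)⁺` of the odd characters;
* **`cmFamilyRank_add_card_eq_iff_pairwise`** — the rank is additive (`Hg(∏ A_i) = ∏ Hg(A_i)`) iff NO odd character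
  is seen by two members (the quantitative form of `CMTypeRankSharedOddCharacter` / `AbelianCMFieldsHodge`: for
  NONDEGENERATE members every odd character trivial on `Gal(L/K_i)` is seen by `Φ_i`, so "seen twice" = "`K_i ∩ K_j`
  not totally real").

Theorems only; no definition, no named fact, no `sorry`.

## Sources

* [Kubota1965] T. Kubota, *On the field extension by complex multiplication*, Trans. AMS 118 (1965), §4 Lemma 2.
* [Gordon1999HodgeAVSurvey] B. B. Gordon, *A survey of the Hodge conjecture for abelian varieties*, Prop. 9.4.1; §3
  Theorem (Imai, Murty) and 7.5–7.7.  [Deligne1982HodgeCycles] P. Deligne, LNM 900 (1982), I Ex. 3.7 (c).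
* [Shimura1998] G. Shimura, *Abelian Varieties with Complex Multiplication and Modular Functions*, §8.1, §18.2 Lemma.
-/

set_option autoImplicit false

noncomputable section

open scoped BigOperators
open NumberField Module

namespace Literature.NumberTheory.ComplexMultiplication
open Literature.AlgebraicGeometry.Motives (CMType)
open Literature.AlgebraicGeometry.Pohlmann1968

variable {I : Type} {K : I → Type} [∀ i, Field (K i)] [∀ i, NumberField (K i)]
variable {L : Type} [Field L] [NumberField L]

/-! ### The dictionary: `Aut(ℂ)` acts on `⊔_i Hom(K_i, ℂ)` through `Gal(L/ℚ)` -/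

section Dictionary
omit [∀ i, NumberField (K i)] in
/-- `(ι ∘ g ∘ e_i)(x) = ι(g(e_i x))`. [folklore] -/
private theorem embG_apply (ι : L →+* ℂ) (e : ∀ i, K i →+* L) (i : I) (g : L ≃ₐ[ℚ] L) (x : K i) :
    ((ι.comp (g : L →+* L)).comp (e i)) x = ι (g (e i x)) := rfl

omit [∀ i, NumberField (K i)] in
/-- `τ ∘ (ι ∘ g ∘ e_i) = ι ∘ (γ g) ∘ e_i` when `τ ∘ ι = ι ∘ γ`. [cite: Shimura1998, §8.1] -/
private theorem smul_embG (ι : L →+* ℂ) (e : ∀ i, K i →+* L) {τ : ℂ ≃+* ℂ} {γ : L ≃ₐ[ℚ] L}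
    (hγ : ∀ y, τ (ι y) = ι (γ y)) (i : I) (g : L ≃ₐ[ℚ] L) :
    τ • (ι.comp (g : L →+* L)).comp (e i) = (ι.comp ((γ * g : L ≃ₐ[ℚ] L) : L →+* L)).comp (e i) := by
  refine RingHom.ext fun x => ?_
  rw [ringEquiv_smul_apply, embG_apply, embG_apply, hγ, AlgEquiv.mul_apply]

variable [Normal ℚ L]

/-- Every complex embedding of `K_i` is `ι ∘ g ∘ e_i` for some `g ∈ Gal(L/ℚ)` (`Aut(ℂ)` is transitive on `Hom(K_i, ℂ)`
and acts on `ι(L)`, `L` normal, through `Gal(L/ℚ)`). [cite: Shimura1998, §8.1] -/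
theorem exists_eq_comp_algEquiv_comp (ι : L →+* ℂ) (e : ∀ i, K i →+* L) (i : I) (s : K i →+* ℂ) :
    ∃ g : L ≃ₐ[ℚ] L, s = (ι.comp (g : L →+* L)).comp (e i) := by
  haveI := isPretransitive_ringEquiv_complex (K := K i)
  obtain ⟨τ, hτ⟩ := MulAction.exists_smul_eq (ℂ ≃+* ℂ) (ι.comp (e i)) s
  obtain ⟨γ, hγ⟩ := exists_algEquiv_comp_eq_smul ι τ
  refine ⟨γ, ?_⟩
  rw [← hτ]
  refine RingHom.ext fun x => ?_
  rw [ringEquiv_smul_apply, RingHom.comp_apply, embG_apply]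
  exact hγ _

/-- **The dictionary for a family.**  `cmFamilyRank Φ` (the rank of the span of the `Aut(ℂ)`-translates of Deligne's
`Σ ⊆ ⊔_i Hom(K_i, ℂ)`) equals the rank of the family `Ψ_i = {g | ι ∘ g ∘ e_i ∈ Φ_i}` of types of `G = Gal(L/ℚ)` acting
on itself: precomposition with `g ↦ ι ∘ g ∘ e_i` is injective and carries the translate by `τ` to the translate by
`r(τ)` (`τ ∘ ι = ι ∘ r(τ)`), and every `g` is an `r(τ)`. [cite: Kubota1965, §4 Lemma 2] [cite: Shimura1998, §8.1] -/
theorem cmFamilyRank_eq_typeRank_gal (ι : L →+* ℂ) (e : ∀ i, K i →+* L) (Φ : ∀ i, CMType (K i)) :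
    CMAlgebra.cmFamilyRank Φ = typeRank (L ≃ₐ[ℚ] L)
      (sigmaType fun i => {g : L ≃ₐ[ℚ] L | (ι.comp (g : L →+* L)).comp (e i) ∈ (Φ i).1}) := by
  let P : ((Σ i, (K i →+* ℂ)) → ℚ) →ₗ[ℚ] ((Σ _ : I, (L ≃ₐ[ℚ] L)) → ℚ) :=
    { toFun := fun f y => f ⟨y.1, (ι.comp ((y.2 : L ≃ₐ[ℚ] L) : L →+* L)).comp (e y.1)⟩
      map_add' := fun _ _ => rfl
      map_smul' := fun _ _ => rfl }
  have hPapp : ∀ (f : (Σ i, (K i →+* ℂ)) → ℚ) (y : Σ _ : I, (L ≃ₐ[ℚ] L)),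
      P f y = f ⟨y.1, (ι.comp ((y.2 : L ≃ₐ[ℚ] L) : L →+* L)).comp (e y.1)⟩ := fun _ _ => rfl
  have hPinj : Function.Injective P := by
    intro f f' hff'
    funext y
    obtain ⟨i, s⟩ := y
    obtain ⟨g, rfl⟩ := exists_eq_comp_algEquiv_comp ι e i s
    have := congrFun hff' ⟨i, g⟩
    rwa [hPapp, hPapp] at this
  -- `τ ↦ γ_τ` with `τ ∘ ι = ι ∘ γ_τ`
  choose r hr using fun τ : ℂ ≃+* ℂ => exists_algEquiv_comp_eq_smul ι τ
  have hP : ∀ τ : ℂ ≃+* ℂ, P (translateInd (CMAlgebra.familyType Φ) τ) =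
      translateInd (sigmaType fun i => {g : L ≃ₐ[ℚ] L | (ι.comp (g : L →+* L)).comp (e i) ∈ (Φ i).1}) (r τ) := by
    intro τ
    funext y
    obtain ⟨i, g⟩ := y
    rw [hPapp, translateInd_sigmaType]
    change translateInd (sigmaType fun i => (Φ i).1) τ ⟨i, (ι.comp (g : L →+* L)).comp (e i)⟩ = _
    rw [translateInd_sigmaType]
    change translateInd (Φ i).1 τ ((ι.comp (g : L →+* L)).comp (e i)) =
      translateInd {g : L ≃ₐ[ℚ] L | (ι.comp (g : L →+* L)).comp (e i) ∈ (Φ i).1} (r τ) g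
    by_cases hm : τ • (ι.comp (g : L →+* L)).comp (e i) ∈ (Φ i).1
    · rw [translateInd_of_mem hm, translateInd_of_mem]
      show (ι.comp ((r τ * g : L ≃ₐ[ℚ] L) : L →+* L)).comp (e i) ∈ (Φ i).1
      rw [← smul_embG ι e (hr τ) i g]
      exact hm
    · rw [translateInd_of_not_mem hm, translateInd_of_not_mem]
      show ¬(ι.comp ((r τ * g : L ≃ₐ[ℚ] L) : L →+* L)).comp (e i) ∈ (Φ i).1
      rw [← smul_embG ι e (hr τ) i g]
      exact hm
  -- every `g` is an `r τ`
  have hsurj : ∀ g : L ≃ₐ[ℚ] L, ∃ τ : ℂ ≃+* ℂ, r τ = g := by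
    intro g
    obtain ⟨τ, hτ⟩ := exists_ringEquiv_comp_eq_algEquiv ι g
    refine ⟨τ, AlgEquiv.ext fun y => ι.injective ?_⟩
    rw [← hr τ y, hτ y]
  have hrange : Set.range (fun g : L ≃ₐ[ℚ] L =>
      translateInd (sigmaType fun i => {g : L ≃ₐ[ℚ] L | (ι.comp (g : L →+* L)).comp (e i) ∈ (Φ i).1}) g) =
      P '' Set.range (fun τ : ℂ ≃+* ℂ => translateInd (CMAlgebra.familyType Φ) τ) := by
    ext v
    simp only [Set.mem_range, Set.mem_image, exists_exists_eq_and, hP]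
    constructor
    · rintro ⟨g, rfl⟩
      obtain ⟨τ, rfl⟩ := hsurj g
      exact ⟨τ, rfl⟩
    · rintro ⟨τ, rfl⟩
      exact ⟨r τ, rfl⟩
  unfold CMAlgebra.cmFamilyRank typeRank
  rw [hrange, ← Submodule.map_span]
  exact LinearEquiv.finrank_eq (Submodule.equivMapOfInjective P hPinj _)

/-- **The dictionary for one member**: `cmTypeRank Φ_i` is the rank of `Ψ_i = {g | ι ∘ g ∘ e_i ∈ Φ_i} ⊆ Gal(L/ℚ)` under
translation. [cite: Kubota1965, §4 Lemma 2] [cite: Shimura1998, §8.1] -/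
theorem cmTypeRank_eq_typeRank_gal_member (ι : L →+* ℂ) (e : ∀ i, K i →+* L) (Φ : ∀ i, CMType (K i)) (i : I) :
    cmTypeRank (Φ i) = typeRank (L ≃ₐ[ℚ] L) {g : L ≃ₐ[ℚ] L | (ι.comp (g : L →+* L)).comp (e i) ∈ (Φ i).1} := by
  let P : ((K i →+* ℂ) → ℚ) →ₗ[ℚ] ((L ≃ₐ[ℚ] L) → ℚ) :=
    { toFun := fun f g => f ((ι.comp (g : L →+* L)).comp (e i))
      map_add' := fun _ _ => rfl
      map_smul' := fun _ _ => rfl }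
  have hPapp : ∀ (f : (K i →+* ℂ) → ℚ) (g : L ≃ₐ[ℚ] L), P f g = f ((ι.comp (g : L →+* L)).comp (e i)) :=
    fun _ _ => rfl
  have hPinj : Function.Injective P := by
    intro f f' hff'
    funext s
    obtain ⟨g, rfl⟩ := exists_eq_comp_algEquiv_comp ι e i s
    have := congrFun hff' g
    rwa [hPapp, hPapp] at this
  choose r hr using fun τ : ℂ ≃+* ℂ => exists_algEquiv_comp_eq_smul ι τ
  have hP : ∀ τ : ℂ ≃+* ℂ, P (translateInd (Φ i).1 τ) =
      translateInd {g : L ≃ₐ[ℚ] L | (ι.comp (g : L →+* L)).comp (e i) ∈ (Φ i).1} (r τ) := by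
    intro τ
    funext g
    rw [hPapp]
    by_cases hm : τ • (ι.comp (g : L →+* L)).comp (e i) ∈ (Φ i).1
    · rw [translateInd_of_mem hm, translateInd_of_mem]
      show (ι.comp ((r τ * g : L ≃ₐ[ℚ] L) : L →+* L)).comp (e i) ∈ (Φ i).1
      rw [← smul_embG ι e (hr τ) i g]
      exact hm
    · rw [translateInd_of_not_mem hm, translateInd_of_not_mem]
      show ¬(ι.comp ((r τ * g : L ≃ₐ[ℚ] L) : L →+* L)).comp (e i) ∈ (Φ i).1
      rw [← smul_embG ι e (hr τ) i g]
      exact hm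
  have hsurj : ∀ g : L ≃ₐ[ℚ] L, ∃ τ : ℂ ≃+* ℂ, r τ = g := by
    intro g
    obtain ⟨τ, hτ⟩ := exists_ringEquiv_comp_eq_algEquiv ι g
    refine ⟨τ, AlgEquiv.ext fun y => ι.injective ?_⟩
    rw [← hr τ y, hτ y]
  have hrange : Set.range (fun g : L ≃ₐ[ℚ] L =>
      translateInd {g : L ≃ₐ[ℚ] L | (ι.comp (g : L →+* L)).comp (e i) ∈ (Φ i).1} g) =
      P '' Set.range (fun τ : ℂ ≃+* ℂ => translateInd (Φ i).1 τ) := by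
    ext v
    simp only [Set.mem_range, Set.mem_image, exists_exists_eq_and, hP]
    constructor
    · rintro ⟨g, rfl⟩
      obtain ⟨τ, rfl⟩ := hsurj g
      exact ⟨τ, rfl⟩
    · rintro ⟨τ, rfl⟩
      exact ⟨r τ, rfl⟩
  unfold cmTypeRank typeRank
  rw [hrange, ← Submodule.map_span]
  exact LinearEquiv.finrank_eq (Submodule.equivMapOfInjective P hPinj _)

end Dictionary

/-! ### Kubota's Lemma 2 for families of CM types of CM subfields of an abelian field -/
section Kubota
variable [IsAbelianGalois ℚ L]

omit [IsAbelianGalois ℚ L] in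
/-- `ρ² = 1` for the complex conjugation `ρ` of `L` with respect to `ι`. [cite: Shimura1998, §18.2 Lemma (i)] -/
private theorem rho_mul_rho (ι : L →+* ℂ) (ρ : L ≃ₐ[ℚ] L) (hρ : ∀ x, ι (ρ x) = starRingEnd ℂ (ι x)) :
    ρ * ρ = 1 := by
  refine AlgEquiv.ext fun x => ι.injective ?_
  rw [AlgEquiv.mul_apply, hρ, hρ, starRingEnd_self_apply, AlgEquiv.one_apply]

omit [IsAbelianGalois ℚ L] [∀ i, NumberField (K i)] in
/-- **The members read on `Gal(L/ℚ)` are CM types for `ρ`** (`ι ∘ ρ ∘ g ∘ e_i` is the conjugate of `ι ∘ g ∘ e_i`; `Gal(L/ℚ)`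
is commutative). [cite: Shimura1998, §18.2 Lemma (i)] -/
theorem isCMTypeWith_gal_member [IsMulCommutative (L ≃ₐ[ℚ] L)] (ι : L →+* ℂ) (e : ∀ i, K i →+* L)
    (ρ : L ≃ₐ[ℚ] L) (hρ : ∀ x, ι (ρ x) = starRingEnd ℂ (ι x)) (Φ : ∀ i, CMType (K i)) (i : I) :
    IsCMTypeWith ρ ({g : L ≃ₐ[ℚ] L | (ι.comp (g : L →+* L)).comp (e i) ∈ (Φ i).1} : Set (L ≃ₐ[ℚ] L)) where
  mem_iff g := by
    show (ι.comp (g : L →+* L)).comp (e i) ∈ (Φ i).1 ↔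
      ¬(ι.comp ((ρ • g : L ≃ₐ[ℚ] L) : L →+* L)).comp (e i) ∈ (Φ i).1
    have hconj : (ι.comp ((ρ * g : L ≃ₐ[ℚ] L) : L →+* L)).comp (e i) =
        ComplexEmbedding.conjugate ((ι.comp (g : L →+* L)).comp (e i)) := by
      refine RingHom.ext fun x => ?_
      rw [embG_apply, AlgEquiv.mul_apply, hρ, ComplexEmbedding.conjugate_coe_eq, embG_apply]
    rw [smul_eq_mul, hconj]
    exact (Φ i).2 _
  comm g g' := by
    show g * (ρ * g') = ρ * (g * g')
    rw [← mul_assoc, mul_comm' g ρ, mul_assoc]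
  invol g := by
    show ρ * (ρ * g) = g
    rw [← mul_assoc, rho_mul_rho ι ρ hρ, one_mul]

variable [Fintype I] [Nonempty I]

open scoped Classical in
/-- **Kubota's Lemma 2 for a family of CM types of CM subfields `e_i : K_i ↪ L` of an ABELIAN number field `L`**:
`rank Y(MT(∏_i A_{Φ_i})) = cmFamilyRank Φ = 1 + #{χ : Gal(L/ℚ) → ℂˣ | χ(ρ) = −1 ∧ ∃ i, Σ_{g : ι∘g∘e_i ∈ Φ_i} χ(g) ≠ 0}` —
the number of ODD characters of `Gal(L/ℚ)` seen by at least one member, plus one.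
[cite: Kubota1965, §4 Lemma 2] [cite: Gordon1999HodgeAVSurvey, §9.4.1 (Proposition [B.60])] -/
theorem cmFamilyRank_eq_one_add_ncard_oddCharacters (ι : L →+* ℂ) (e : ∀ i, K i →+* L) (ρ : L ≃ₐ[ℚ] L)
    (hρ : ∀ x, ι (ρ x) = starRingEnd ℂ (ι x)) (Φ : ∀ i, CMType (K i)) :
    CMAlgebra.cmFamilyRank Φ = 1 + {χ : AddChar (Additive (L ≃ₐ[ℚ] L)) ℂ | χ (Additive.ofMul ρ) = -1 ∧
      ∃ i, ∑ g ∈ Finset.univ.filter (fun g : L ≃ₐ[ℚ] L => (ι.comp (g : L →+* L)).comp (e i) ∈ (Φ i).1),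
        χ (Additive.ofMul g) ≠ 0}.ncard := by
  have hcm := isCMTypeWith_gal_member ι e ρ hρ Φ
  rw [cmFamilyRank_eq_typeRank_gal ι e Φ]
  letI : CommGroup (L ≃ₐ[ℚ] L) := { (inferInstance : Group (L ≃ₐ[ℚ] L)) with mul_comm := mul_comm' }
  rw [IsCMTypeWith.typeRank_sigmaType_eq_one_add_ncard_oddCharacters_free hcm]
  congr 2
  ext χ
  simp only [Set.mem_setOf_eq]
  refine and_congr_right fun _ => exists_congr fun i => ?_
  rw [Finset.sum_filter]
  refine Iff.of_eq (congrArg (· ≠ 0) (Finset.sum_congr rfl fun g _ => ?_))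
  by_cases hg : (ι.comp (g : L →+* L)).comp (e i) ∈ (Φ i).1
  · rw [if_pos hg, translateInd_of_mem (show (1 : L ≃ₐ[ℚ] L) • g ∈ _ by rwa [one_smul]), Rat.cast_one, one_mul]
  · rw [if_neg hg, translateInd_of_not_mem (show ¬(1 : L ≃ₐ[ℚ] L) • g ∈ _ by rwa [one_smul]), Rat.cast_zero,
      zero_mul]

omit [Fintype I] [Nonempty I] in
open scoped Classical in
/-- **The member `i` read on `Gal(L/ℚ)`**: `cmTypeRank Φ_i = 1 + #{χ : Gal(L/ℚ) → ℂˣ | χ(ρ) = −1, Σ_{g : ι∘g∘e_i ∈ Φ_i}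
χ(g) ≠ 0}` (Kubota/Gordon 9.4.1 for the abelian field `K_i`, re-read on the larger group `Gal(L/ℚ)`: characters
non-trivial on `Gal(L/K_i)` contribute nothing). [cite: Kubota1965, §4 Lemma 2] [cite: Gordon1999HodgeAVSurvey, §9.4.1] -/
theorem cmTypeRank_eq_one_add_ncard_oddCharacters_member (ι : L →+* ℂ) (e : ∀ i, K i →+* L) (ρ : L ≃ₐ[ℚ] L)
    (hρ : ∀ x, ι (ρ x) = starRingEnd ℂ (ι x)) (Φ : ∀ i, CMType (K i)) (i : I) :
    cmTypeRank (Φ i) = 1 + {χ : AddChar (Additive (L ≃ₐ[ℚ] L)) ℂ | χ (Additive.ofMul ρ) = -1 ∧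
      ∑ g ∈ Finset.univ.filter (fun g : L ≃ₐ[ℚ] L => (ι.comp (g : L →+* L)).comp (e i) ∈ (Φ i).1),
        χ (Additive.ofMul g) ≠ 0}.ncard := by
  have hset : ({g : L ≃ₐ[ℚ] L | (ι.comp (g : L →+* L)).comp (e i) ∈ (Φ i).1} : Set (L ≃ₐ[ℚ] L)) =
      ↑(Finset.univ.filter fun g : L ≃ₐ[ℚ] L => (ι.comp (g : L →+* L)).comp (e i) ∈ (Φ i).1) := by
    ext g; simp
  have hcm := isCMTypeWith_gal_member ι e ρ hρ Φ i
  rw [cmTypeRank_eq_typeRank_gal_member ι e Φ i, hset]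
  rw [hset] at hcm
  letI : CommGroup (L ≃ₐ[ℚ] L) := { (inferInstance : Group (L ≃ₐ[ℚ] L)) with mul_comm := mul_comm' }
  exact hcm.typeRank_eq_one_add_ncard_oddCharacters

end Kubota

/-! ### The multiplicity formula: the additivity defect counts the odd characters seen twice -/

section Multiplicity
variable [IsAbelianGalois ℚ L] [Fintype I] [Nonempty I]

open scoped IsMulCommutative Classical in
/-- **The multiplicity formula.**  Let `S_i = {χ : χ(ρ) = −1, Σ_{g : ι∘g∘e_i ∈ Φ_i} χ(g) ≠ 0}` be the odd support of the
member `i` and `n_χ = #{i : χ ∈ S_i}` the number of members seeing `χ`.  Then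
`cmFamilyRank Φ + |I| + Σ_χ (n_χ − 1) = Σ_i cmTypeRank Φ_i + 1` (truncated subtraction): the additivity defect
`Σ_i rank Hg(A_i) − rank Hg(∏_i A_i)` is the total excess multiplicity of the odd characters
(`rank(Σ) − 1 = |⋃_i S_i|`, `rank(Φ_i) − 1 = |S_i|`). [cite: Kubota1965, §4 Lemma 2]
[cite: Gordon1999HodgeAVSurvey, §3 Theorem (proof) and 9.4.1] -/
theorem cmFamilyRank_add_card_add_sum_eq (ι : L →+* ℂ) (e : ∀ i, K i →+* L) (ρ : L ≃ₐ[ℚ] L)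
    (hρ : ∀ x, ι (ρ x) = starRingEnd ℂ (ι x)) (Φ : ∀ i, CMType (K i)) :
    CMAlgebra.cmFamilyRank Φ + Fintype.card I +
        ∑ χ : AddChar (Additive (L ≃ₐ[ℚ] L)) ℂ,
          ((Finset.univ.filter fun i : I => χ (Additive.ofMul ρ) = -1 ∧
            ∑ g ∈ Finset.univ.filter (fun g : L ≃ₐ[ℚ] L => (ι.comp (g : L →+* L)).comp (e i) ∈ (Φ i).1),
              χ (Additive.ofMul g) ≠ 0).card - 1) =
      (∑ i, cmTypeRank (Φ i)) + 1 := by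
  -- the predicate "`χ ∈ S_i`"
  let P : I → AddChar (Additive (L ≃ₐ[ℚ] L)) ℂ → Prop := fun i χ => χ (Additive.ofMul ρ) = -1 ∧
    ∑ g ∈ Finset.univ.filter (fun g : L ≃ₐ[ℚ] L => (ι.comp (g : L →+* L)).comp (e i) ∈ (Φ i).1),
      χ (Additive.ofMul g) ≠ 0
  have hPdef : ∀ i χ, P i χ ↔ (χ (Additive.ofMul ρ) = -1 ∧
      ∑ g ∈ Finset.univ.filter (fun g : L ≃ₐ[ℚ] L => (ι.comp (g : L →+* L)).comp (e i) ∈ (Φ i).1),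
        χ (Additive.ofMul g) ≠ 0) := fun _ _ => Iff.rfl
  show CMAlgebra.cmFamilyRank Φ + Fintype.card I + ∑ χ, ((Finset.univ.filter fun i : I => P i χ).card - 1) =
    (∑ i, cmTypeRank (Φ i)) + 1
  -- the two formulas, with `Finset` cardinalities
  have hfam : CMAlgebra.cmFamilyRank Φ = 1 + (Finset.univ.filter fun χ => ∃ i, P i χ).card := by
    have hS : {χ : AddChar (Additive (L ≃ₐ[ℚ] L)) ℂ | χ (Additive.ofMul ρ) = -1 ∧
        ∃ i, ∑ g ∈ Finset.univ.filter (fun g : L ≃ₐ[ℚ] L => (ι.comp (g : L →+* L)).comp (e i) ∈ (Φ i).1),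
          χ (Additive.ofMul g) ≠ 0} = ↑(Finset.univ.filter fun χ => ∃ i, P i χ) := by
      ext χ
      simp only [Set.mem_setOf_eq, Finset.coe_filter, Finset.mem_univ, true_and, hPdef]
      exact ⟨fun ⟨h1, i, h2⟩ => ⟨i, h1, h2⟩, fun ⟨i, h1, h2⟩ => ⟨h1, i, h2⟩⟩
    rw [cmFamilyRank_eq_one_add_ncard_oddCharacters ι e ρ hρ Φ, hS, Set.ncard_coe_finset]
  have hmem : ∀ i, cmTypeRank (Φ i) = 1 + (Finset.univ.filter fun χ => P i χ).card := by
    intro i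
    have hS : {χ : AddChar (Additive (L ≃ₐ[ℚ] L)) ℂ | χ (Additive.ofMul ρ) = -1 ∧
        ∑ g ∈ Finset.univ.filter (fun g : L ≃ₐ[ℚ] L => (ι.comp (g : L →+* L)).comp (e i) ∈ (Φ i).1),
          χ (Additive.ofMul g) ≠ 0} = ↑(Finset.univ.filter fun χ => P i χ) := by
      ext χ
      simp only [Set.mem_setOf_eq, Finset.coe_filter, Finset.mem_univ, true_and, hPdef]
    rw [cmTypeRank_eq_one_add_ncard_oddCharacters_member ι e ρ hρ Φ i, hS, Set.ncard_coe_finset]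
  -- `Σ_i |S_i| = Σ_χ n_χ` (double counting)
  have hdouble : ∑ i, (Finset.univ.filter fun χ => P i χ).card =
      ∑ χ : AddChar (Additive (L ≃ₐ[ℚ] L)) ℂ, (Finset.univ.filter fun i : I => P i χ).card := by
    simp only [Finset.card_filter]
    exact Finset.sum_comm
  -- `|⋃_i S_i| + Σ_χ (n_χ − 1) = Σ_χ n_χ`
  have hunion : (Finset.univ.filter fun χ => ∃ i, P i χ).card +
      ∑ χ : AddChar (Additive (L ≃ₐ[ℚ] L)) ℂ, ((Finset.univ.filter fun i : I => P i χ).card - 1) =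
      ∑ χ : AddChar (Additive (L ≃ₐ[ℚ] L)) ℂ, (Finset.univ.filter fun i : I => P i χ).card := by
    rw [Finset.card_filter, ← Finset.sum_add_distrib]
    refine Finset.sum_congr rfl fun χ _ => ?_
    by_cases hχ : ∃ i, P i χ
    · rw [if_pos hχ]
      have hpos : 0 < (Finset.univ.filter fun i : I => P i χ).card := by
        obtain ⟨i, hi⟩ := hχ
        exact Finset.card_pos.2 ⟨i, Finset.mem_filter.2 ⟨Finset.mem_univ _, hi⟩⟩
      omega
    · rw [if_neg hχ]
      have h0 : (Finset.univ.filter fun i : I => P i χ).card = 0 := by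
        rw [Finset.card_eq_zero, Finset.filter_eq_empty_iff]
        exact fun i _ hi => hχ ⟨i, hi⟩
      omega
  rw [hfam, Finset.sum_congr rfl fun i _ => hmem i, Finset.sum_add_distrib, Finset.sum_const, Finset.card_univ,
    smul_eq_mul, mul_one, hdouble, ← hunion]
  ring

open scoped IsMulCommutative Classical in
/-- **The rank is additive iff no odd character is seen by two members**: `cmFamilyRank Φ + |I| = Σ_i cmTypeRank Φ_i + 1`
(`Hg(∏_i A_{Φ_i}) = ∏_i Hg(A_{Φ_i})`) iff for all `i ≠ j` no odd `χ` has both character sums non-zero — the quantitative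
form of the shared-odd-character obstruction (`CMTypeRankSharedOddCharacter`). [cite: Kubota1965, §4 Lemma 2]
[cite: Gordon1999HodgeAVSurvey, §3 Theorem (proof) and 7.5] -/
theorem cmFamilyRank_add_card_eq_iff_pairwise (ι : L →+* ℂ) (e : ∀ i, K i →+* L) (ρ : L ≃ₐ[ℚ] L)
    (hρ : ∀ x, ι (ρ x) = starRingEnd ℂ (ι x)) (Φ : ∀ i, CMType (K i)) :
    CMAlgebra.cmFamilyRank Φ + Fintype.card I = (∑ i, cmTypeRank (Φ i)) + 1 ↔
      ∀ χ : AddChar (Additive (L ≃ₐ[ℚ] L)) ℂ, χ (Additive.ofMul ρ) = -1 → ∀ i j : I, i ≠ j →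
        ¬(∑ g ∈ Finset.univ.filter (fun g : L ≃ₐ[ℚ] L => (ι.comp (g : L →+* L)).comp (e i) ∈ (Φ i).1),
              χ (Additive.ofMul g) ≠ 0 ∧
          ∑ g ∈ Finset.univ.filter (fun g : L ≃ₐ[ℚ] L => (ι.comp (g : L →+* L)).comp (e j) ∈ (Φ j).1),
              χ (Additive.ofMul g) ≠ 0) := by
  let P : I → AddChar (Additive (L ≃ₐ[ℚ] L)) ℂ → Prop := fun i χ => χ (Additive.ofMul ρ) = -1 ∧
    ∑ g ∈ Finset.univ.filter (fun g : L ≃ₐ[ℚ] L => (ι.comp (g : L →+* L)).comp (e i) ∈ (Φ i).1),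
      χ (Additive.ofMul g) ≠ 0
  have hPdef : ∀ i χ, P i χ ↔ (χ (Additive.ofMul ρ) = -1 ∧
      ∑ g ∈ Finset.univ.filter (fun g : L ≃ₐ[ℚ] L => (ι.comp (g : L →+* L)).comp (e i) ∈ (Φ i).1),
        χ (Additive.ofMul g) ≠ 0) := fun _ _ => Iff.rfl
  have key : CMAlgebra.cmFamilyRank Φ + Fintype.card I + ∑ χ, ((Finset.univ.filter fun i : I => P i χ).card - 1) =
      (∑ i, cmTypeRank (Φ i)) + 1 := cmFamilyRank_add_card_add_sum_eq ι e ρ hρ Φ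
  have hiff : CMAlgebra.cmFamilyRank Φ + Fintype.card I = (∑ i, cmTypeRank (Φ i)) + 1 ↔
      ∀ χ, (Finset.univ.filter fun i : I => P i χ).card ≤ 1 := by
    constructor
    · intro h χ
      have hsum : ∑ χ, ((Finset.univ.filter fun i : I => P i χ).card - 1) = 0 := by omega
      have := (Finset.sum_eq_zero_iff.1 hsum) χ (Finset.mem_univ _)
      omega
    · intro h
      have hsum : ∑ χ, ((Finset.univ.filter fun i : I => P i χ).card - 1) = 0 :=
        Finset.sum_eq_zero fun χ _ => by have := h χ; omega
      omega
  rw [hiff]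
  refine forall_congr' fun χ => ?_
  rw [Finset.card_le_one]
  simp only [Finset.mem_filter, Finset.mem_univ, true_and, hPdef]
  constructor
  · intro h hχ i j hij hboth
    exact hij (h i ⟨hχ, hboth.1⟩ j ⟨hχ, hboth.2⟩)
  · intro h i hi j hj
    by_contra hij
    exact h hi.1 i j hij ⟨hi.2, hj.2⟩

end Multiplicity

end Literature.NumberTheory.ComplexMultiplication
end
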